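import Mathlib.Algebra.Group.Prod
import Mathlib.Algebra.Group.Subgroup.Basic
import Mathlib.Algebra.Ring.Hom.Defs
import Mathlib.Algebra.Group.Units.Hom
import Mathlib.GroupTheory.QuotientGroup.Defs
import Mathlib.Data.Real.Basic
import HarnessLib

/-!
# [IUTchIII] §1, Remarks 1.1.1 – 1.5.4 (BLOCK D′): units-only log-links, upper semi-commutativity, the
# log-wall, non-commutativity of the log-theta-lattice, conjugate synchronization — expository remarks

Mochizuki, *Inter-universal Teichmüller theory III: canonical splittings of the log-theta-lattice*, §1,
kurims manuscript (May 2020) pp. 28–57: Remarks 1.1.1 (i), 1.1.2 (ii), 1.2.1 (i), 1.2.2 (iii)–(vii), 1.2.4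
(i)–(iii), 1.2.5, 1.3.2, 1.3.3 (i)(ii), 1.4.1 (i)–(iii), 1.4.2 (i)(ii), 1.5.1 (i)(iii), 1.5.2 (i)–(iii), 1.5.3
(i)–(iii), 1.5.4 (ii)(iii) [claim: Mochizuki2012, status: disputed] (IUTchIII §1 Rmks 1.1.1-1.5.4, kurims pp.28-57).
Record-only typing under the claim key `Mochizuki2012` (D-0012, disputed); abc-iut-L6 BLOCK D′ (L6-lead RE-SLICE
18:49:28Z, 30 nodes), typed by abc-iut-L6-t1; NOT here (abc-iut-L6-t3's): `Rmk1.1.1(ii)`, `Rmk1.1.2(i)`,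
`Rmk1.2.1(ii)`, `Rmk1.2.2(i)(ii)`, `Rmk1.2.3`, `Rmk1.3.1`, `Rmk1.5.1(ii)`, `Rmk1.5.4(i)`.

These Remarks are EXPOSITORY (C1): they interpret Prop. 1.2 / 1.3, Def. 1.4 and Thm. 1.5 (owner abc-iut-L6-t3)
and contain no construction. Where a sentence is a crisp mathematical claim it is typed below as a named
`Prop` over a minimal local interface or PROVED when it is a group-theoretic identity; everything else is
recorded in this docstring, node by node (status `noted`):
* `IUTchIII:Rmk1.1.1(i)` (p. 28) — "log-links may be thought of as correspondences between certain portions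
  of the ind-topological monoids in the domain … and … codomain"; iterates of log-links "are to be understood
  as being defined only on the [local] units … the only reason for the introduction of log-links is to render
  possible the construction of the log-shells from the various [local] units" — typed: `unitsOnlyIterate`
  (the convention as a DEFINITION: the `n`-fold iterate of a partial map defined on units).
* `IUTchIII:Rmk1.1.2(ii)` (p. 29) — "An analogous discussion to that of (i) [tautological identification of
  the `†Π_v`'s for the tautological log-link vs. full poly-isomorphism for the full log-link] may be given
  … in the case of `v ∈ V^arc`. We leave the routine details to the reader." Noted.
* `IUTchIII:Rmk1.2.2(iii)` (pp. 36–37) — "the coric holomorphic log-shells … contain not only the images,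
  via the Kummer isomorphisms …, of the various `O^⊳` at `v ∈ V^non`, but also the images, via the composite of
  the Kummer isomorphisms with the various iterates … of the log-link, of the portions of the various `O^⊳` … on
  which these iterates are defined … a sort of upper semi-commutativity" — typed: `UpperSemiCommutative`
  (DEFINED predicate) with the formal consequence `UpperSemiCommutative.iUnion_subset` PROVED;
  `IUTchIII:Rmk1.2.2(iv)` — no "lower semi-commutativity" ("it is difficult to see how to construct such a
  collection"), noted; `IUTchIII:Rmk1.2.2(v)` — "commutative with respect to log-volumes" = Prop. 1.2 (iii)
  (t3), typed abstractly: `LogVolumeCommutative` (DEFINED predicate: a real-valued function invariant under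
  every arrow of a family) + `LogVolumeCommutative.comp_list` PROVED; `IUTchIII:Rmk1.2.2(vi)`,
  `IUTchIII:Rmk1.2.2(vii)` (pp. 37–38, Fig. 1.1) — "juggling of ⊞, ⊠", the horizontal arrows as an unraveling
  of an "oriented copy of `S¹`", Frobenius-like structures as "coordinate functions `∫• dθ`" vs étale-like
  "invariant differential `dθ`". Noted.
* `IUTchIII:Rmk1.2.1(i)` (p. 35) — the "weight `N`" convention: `Ψ^gp_{†ℱ_v}/Ψ^{μ_N}_{†ℱ_v}` carries the
  descended metric but is "regarded as being equipped with a weight `N` — i.e., which has the effect of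
  ensuring that the log-volume of `Ψ^×_{†ℱ_v}/Ψ^{μ_N}_{†ℱ_v}` is equal to that of `Ψ^×_{†ℱ_v}`" — typed:
  `WeightConvention`.
* `IUTchIII:Rmk1.2.4(i)` (p. 39) — "the log-link is incompatible with the ring structures of `Ψ^gp_{†ℱ_v}` and
  `Ψ^gp_{log(†ℱ_v)}` …, in the sense that it does not arise from a ring homomorphism between these two rings"
  (the "log-wall" of [AbsTopIII] §I4); consequently Galois groups "as automorphism groups of some ring
  structure" and Kummer theory are incompatible with the log-wall, and "the only structure … manifestly
  compatible with the log-link is the associated `𝒟`-prime-strip" — typed: `NotFromRingHom` (named `Prop`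
  with the two rings and the log map as parameters).
* `IUTchIII:Rmk1.2.4(ii)` (p. 40) — further structures incompatible with the log-wall: (a) the additive
  structure on the image of the Kummer map; (b) in the birational situation, the datum of the collection of
  closed points (the outer surjection `Π^birat_v ↠ Π_v`). Noted.
* `IUTchIII:Rmk1.2.4(iii)` (pp. 40–41, Fig. 1.2) — `G_v`, `Δ^birat_v`, `Δ_v` make sense on both sides of the
  log-wall as topological groups with outer `G_v`-actions, but a PARTICULAR outer surjection `Δ^birat_v ↠ Δ_v`
  does not ("triangular compatibility between independent indeterminacies"; cf. [IUTchI] Rmk. 4.5.1 (i),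
  [IUTchII] Rmk. 2.5.2 (ii)). Noted.
* `IUTchIII:Rmk1.2.5` (p. 41) — mono-anabelian algorithms as algorithms whose dependence on fixed
  ring/scheme-theoretic reference models is "coric" with respect to `log` ([AbsTopIII] §3: observables,
  families of homotopies, telecores; Cor. 3.6 (iv), 3.7 (iv)). Noted.
* `IUTchIII:Rmk1.3.2` (pp. 43–44) — the log-links of Prop. 1.3 (i) for the `†ℱ_t`, `t ∈ T`, "are in fact
  compatible with the `𝔽_l^{⋊±}`-symmetrizing isomorphisms discussed in [IUTchII], Corollary 4.6, (iii), hence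
  also with the conjugate synchronization" ("We leave the routine details to the reader"; used in Cor. 3.12
  Step (vi)) — typed: `Rmk132_logLinkCompatible` (named `Prop` over an interface: a family of maps commuting
  with a family of symmetrising isomorphisms).
* `IUTchIII:Rmk1.3.3(i)`, `IUTchIII:Rmk1.3.3(ii)` (pp. 44–45) — the Frobenioid-theoretic portions of the Hodge theaters in
  domain/codomain of the log-link carry no data incompatible with the coricity of Prop. 1.3 (ii), being
  "completely [i.e., fully faithfully!] controlled … by the corresponding étale-like structures" ([IUTchI]
  Cor. 5.3, 5.6); (ii) lists the portions (a) F-prime-strips, (b) underlying Θ-Hodge theaters, (c) global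
  portion of NF-bridges, and where independent basepoints are harmless (full poly-isomorphisms) or
  delicate (the `Θ^{±ell}` part, resolved by the intrinsic ±-synchronization). Noted.
* `IUTchIII:Rmk1.4.1(i)` (p. 46) — "the various squares that appear in each of the log-theta-lattices … are
  far from being [1-]commutative!" — typed: `Rmk141_notCommutative` (named `Prop` over an abstract lattice of
  maps); `IUTchIII:Rmk1.4.1(ii)` (pp. 46–47) — each horizontal arrow "necessarily obligates a subsequent execution of a
  vertical arrow"; multiradiality requires "vertical cores"; `IUTchIII:Rmk1.4.1(iii)` (p. 47, Fig. 1.3) — analogy: vertical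
  arrows ↔ Frobenius in positive characteristic, horizontal arrows ↔ mixed-characteristic extension structure
  of Witt vectors. Noted.
* `IUTchIII:Rmk1.4.2(i)`, `IUTchIII:Rmk1.4.2(ii)` (pp. 47–48) — vertical linking data rigid (one arithmetic holomorphic
  structure), horizontal linking data (the `O^{×μ}`'s) subject to a `Ẑ^×`-indeterminacy ([IUTchII] Rmk.
  1.11.2); "forcing" horizontal arrows to respect `Π_v` gains nothing (paths / universal coverings of loops;
  [IUTchIV] Rmk. 3.6.3). Noted.
* `IUTchIII:Rmk1.5.1(i)` (p. 51) — conjugate synchronization ([IUTchII] Cor. 4.5 (iii), 4.6 (iii)) as the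
  descent mechanism from label-dependent to label-independent data behind the bi-coricity of Thm. 1.5
  (iii)–(v); `IUTchIII:Rmk1.5.1(iii)` (p. 52) — analogy with label synchronization ([IUTchI] Rmk. 4.9.2). Noted. (The
  group-theoretic identity quoted in `(ii)` — t3's node — is PROVED below as `conj_diag_eq_commutator_mul` for
  use by that node's decl: `(g, hgh⁻¹) = (g, [h,g]·g)`.)
* `IUTchIII:Rmk1.5.2(i)`, `IUTchIII:Rmk1.5.2(ii)`, `IUTchIII:Rmk1.5.2(iii)` (pp. 52–54) — no conjugate synchronization for the `𝔽_l^⋇`-symmetry on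
  labeled copies of `F̄` ([IUTchII] Rmk. 4.7.2); hence no bi-coric "`F^×_sol`"; bi-coric mono-analytic
  log-shells as "multiradial containers" for labeled copies of `F_mod`; Kummer theory for constructions "not
  bound to conventional scheme theory"; global Frobenioids of copies of `F^×_mod` give genuine arithmetic
  line bundles (push-forward to `ℤ`, tensor products — used in §3 and [IUTchIV]). Noted.
* `IUTchIII:Rmk1.5.3(i)`, `IUTchIII:Rmk1.5.3(ii)`, `IUTchIII:Rmk1.5.3(iii)` (pp. 54–55, Fig. 1.4) — analogy ([QuCnf], [AbsTopIII] Prop. 2.6 / Cor.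
  2.7): conjugate synchronization ↔ squares/rectangles representing a holomorphic structure; the naive
  quotient of Rmk. 1.5.1 (ii) ↔ holomorphic structures modulo Teichmüller deformation; the `κ`-sol-conjugate
  synchronization of realified global Frobenioids and their `ℝ_{>0}`-action. Noted.
* `IUTchIII:Rmk1.5.4(ii)`, `IUTchIII:Rmk1.5.4(iii)` (pp. 56–57) — étale-transport indeterminacies = those of anabelian /
  group-theoretic algorithms (e.g. automorphisms of `G_v` not of scheme-theoretic origin, [AbsTopIII] §I3);
  Kummer-detachment indeterminacies, e.g. the choice of path in the Frobenius-picture diagrams of Prop. 1.2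
  (x) / 1.3 (iv) bounded above by the upper semi-commutativity of coric log-shells, and the
  `Ẑ^×`-indeterminacies of Rmk. 1.4.2. Noted (the dichotomy itself, `(i)`, is t3's `IndeterminacyKind`).

Interfaces used below are local and minimal (no TODO-merge owner: they abstract a sentence, not an object of
another seat). Nothing here asserts anything about [IUTchIII] Cor. 3.12.
-/

namespace Literature.IUT.LogThetaLattice

universe u

/-! ## Rmk 1.1.1 (i): iterates of log-links are defined on units only -/

/-- **IUTchIII:Rmk1.1.1(i)** (kurims p. 28): "The log-links … that appear in such iterates are to be understood as
being defined only on the [local] units that appear in the domains of these log-links." DEFINED: the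
`n`-fold iterate of a "log-link" given as a map `lg` from the units of a carrier `M` (a predicate
`IsUnitLike`) to `M`, as a PARTIAL map (`Option`-valued) defined at stage `n+1` exactly on those elements
whose `n`-th iterate is again a unit. [claim: Mochizuki2012, status: disputed] (IUTchIII §1 Rmk 1.1.1 (i), kurims p.28) -/
def unitsOnlyIterate {M : Type u} (IsUnitLike : M → Prop) [DecidablePred IsUnitLike]
    (lg : {x : M // IsUnitLike x} → M) : ℕ → M → Option M
  | 0, x => some x
  | n + 1, x =>
    match unitsOnlyIterate IsUnitLike lg n x with
    | none => none
    | some y => if h : IsUnitLike y then some (lg ⟨y, h⟩) else none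

/-! ## Rmk 1.2.2 (iii), (v): upper semi-commutativity; commutativity of log-volumes -/

/-- **IUTchIII:Rmk1.2.2(iii)** (kurims pp. 36–37): "although the diagram [corresponding to] `Γ⃗` fails to be
commutative, the coric holomorphic log-shells involved exhibit a sort of upper semi-commutativity with
respect to containing … the various images arising from composites of arrows in `Γ⃗`." DEFINED predicate:
a container `shell` (the coric holomorphic log-shell at `v ∈ V^non`) contains every member of a family of
images (indexed by the composites of arrows, e.g. by the number of log-iterates preceding the Kummer
isomorphism). [claim: Mochizuki2012, status: disputed] (IUTchIII §1 Rmk 1.2.2 (iii), kurims pp.36-37) -/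
def UpperSemiCommutative {X : Type u} {ι : Type u} (shell : Set X) (images : ι → Set X) : Prop :=
  ∀ i, images i ⊆ shell

/-- **IUTchIII:Rmk1.2.2(iii)**, formal consequence PROVED: under upper semi-commutativity the union of all the
images (over all composites of arrows) lies in the shell — the form in which the containments are used as
an "upper estimate" (Rmk. 1.5.4 (iii)). [claim: Mochizuki2012, status: disputed] (IUTchIII §1 Rmk 1.2.2 (iii), kurims p.37) -/
theorem UpperSemiCommutative.iUnion_subset {X : Type u} {ι : Type u} {shell : Set X} {images : ι → Set X}
    (h : UpperSemiCommutative shell images) : (⋃ i, images i) ⊆ shell :=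
  Set.iUnion_subset h

/-- **IUTchIII:Rmk1.2.2(v)** (kurims p. 37): "although the diagram corresponding to `Γ⃗` fails to be commutative,
it is nevertheless commutative with respect to log-volumes, in the sense discussed in Proposition 1.2, (iii).
This … allows one to work with log-volumes in a fashion that is consistent with all composites of the
various arrows of `Γ⃗`." DEFINED predicate (abstractly; Prop. 1.2 (iii) itself is abc-iut-L6-t3's): a
real-valued function on the carriers is invariant under every arrow of a family of maps.
[claim: Mochizuki2012, status: disputed] (IUTchIII §1 Rmk 1.2.2 (v), kurims p.37) -/
def LogVolumeCommutative {X : Type u} {ι : Type u} (arrows : ι → X → X) (logVol : X → ℝ) : Prop :=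
  ∀ (i : ι) (x : X), logVol (arrows i x) = logVol x

/-- **IUTchIII:Rmk1.2.2(v)**, PROVED: commutativity with respect to log-volumes passes to every composite of
arrows ("consistent with all composites of the various arrows"). [claim: Mochizuki2012, status: disputed] (IUTchIII §1 Rmk 1.2.2 (v), kurims p.37) -/
theorem LogVolumeCommutative.comp_list {X : Type u} {ι : Type u} {arrows : ι → X → X} {logVol : X → ℝ}
    (h : LogVolumeCommutative arrows logVol) (l : List ι) (x : X) :
    logVol (l.foldr (fun i acc => arrows i acc) x) = logVol x := by
  induction l with
  | nil => rfl
  | cons i t ih => rw [List.foldr_cons, h i, ih]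

/-! ## Rmk 1.2.1 (i): the weight convention -/

/-- **IUTchIII:Rmk1.2.1(i)** (kurims p. 35): "we regard the object `Ψ^gp_{†ℱ_v}/Ψ^{μ_N}_{†ℱ_v}` [or
`Ψ^×_{†ℱ_v}/Ψ^{μ_N}_{†ℱ_v}`] as being equipped with a weight `N` — i.e., which has the effect of ensuring that
the log-volume of `Ψ^×_{†ℱ_v}/Ψ^{μ_N}_{†ℱ_v}` is equal to that of `Ψ^×_{†ℱ_v}`. That is to say, this
convention concerning weights ensures that working with `Ψ^gp_{†ℱ_v}/Ψ^{μ_N}_{†ℱ_v}` does not have any effect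
on various computations of log-volume." Typed as the convention relating a log-volume on subsets of a group
`A` and one on subsets of its quotient by a finite subgroup of order `N`: the quotient's log-volume of the
image of a `μ_N`-saturated set equals the original log-volume (the factor `N` being absorbed by the weight).
[claim: Mochizuki2012, status: disputed] (IUTchIII §1 Rmk 1.2.1 (i), kurims p.35) -/
structure WeightConvention (A : Type u) [CommGroup A] (μN : Subgroup A) : Type u where
  /-- log-volume on (measurable) subsets of `Ψ^×` (partial: `none` outside the domain) -/
  logVol : Set A → Option ℝ
  /-- the weight-`N` log-volume on subsets of `Ψ^×/Ψ^{μ_N}` -/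
  logVolQuot : Set (A ⧸ μN) → Option ℝ
  /-- the convention: for `μ_N`-saturated `S`, `logVolQuot (image S) = logVol S` -/
  weight_convention : ∀ S : Set A, (∀ a ∈ S, ∀ z ∈ μN, z * a ∈ S) →
    logVolQuot (QuotientGroup.mk '' S) = logVol S

/-! ## Rmk 1.2.4 (i): the log-wall -/

/-- **IUTchIII:Rmk1.2.4(i)** (kurims p. 39): "the log-link is incompatible with the ring structures of
`Ψ^gp_{†ℱ_v}` and `Ψ^gp_{log(†ℱ_v)}` …, in the sense that it does not arise from a ring homomorphism between
these two rings" — the "log-wall" ([AbsTopIII] §I4). Typed for rings `R₁` (`Ψ^gp_{†ℱ_v} ∪ {0}`), `R₂`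
(`Ψ^gp_{log(†ℱ_v)} ∪ {0}`) and the map `lg` underlying the log-link on the units of `R₁` (the `p_v`-adic
logarithm, a homomorphism from the multiplicative to the additive structure): no ring homomorphism
`R₁ → R₂` restricts to `lg` on the units. Named `Prop` with parameters (the instance — `k^× → k`,
`x ↦ log_p x` — is a classical fact: `log(xy) = log x + log y ≠ log x · log y` in general).
[claim: Mochizuki2012, status: disputed] (IUTchIII §1 Rmk 1.2.4 (i), kurims p.39) -/
def NotFromRingHom (R₁ R₂ : Type u) [Ring R₁] [Ring R₂] (lg : R₁ˣ →* Multiplicative R₂) : Prop :=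
  ¬ ∃ f : R₁ →+* R₂, ∀ x : R₁ˣ, f (x : R₁) = Multiplicative.toAdd (lg x)

/-- **IUTchIII:Rmk1.2.4(i)**, PROVED toy instance of the log-wall phenomenon: a map on units that sends some
unit to `0` while the target ring is nontrivial cannot be the restriction of a ring homomorphism (a ring
homomorphism sends units to units, and `1 ↦ 1 ≠ 0`; the logarithm sends `1 ↦ 0`).
[claim: Mochizuki2012, status: disputed] (IUTchIII §1 Rmk 1.2.4 (i), kurims p.39) -/
theorem notFromRingHom_of_map_one {R₁ R₂ : Type u} [Ring R₁] [Ring R₂] [Nontrivial R₂]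
    (lg : R₁ˣ →* Multiplicative R₂) : NotFromRingHom R₁ R₂ lg := by
  rintro ⟨f, hf⟩
  have h1 := hf 1
  rw [map_one, Units.val_one, map_one] at h1
  exact one_ne_zero (h1.trans toAdd_one)

/-! ## Rmk 1.3.2: compatibility of the log-links with the `𝔽_l^{⋊±}`-symmetrizing isomorphisms -/

/-- **IUTchIII:Rmk1.3.2** (kurims pp. 43–44): "one verifies immediately that the log-links associated, in the
construction of Proposition 1.3, (i), to these F-prime-strips `†ℱ_t`, for `t ∈ T` — i.e., more precisely,
associated to the labeled collections of monoids `Ψ_cns(†𝔉_≻)_t` of [IUTchII], Corollary 4.6, (iii) — are in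
fact compatible with the `𝔽_l^{⋊±}`-symmetrizing isomorphisms discussed in [IUTchII], Corollary 4.6, (iii),
hence also with the conjugate synchronization determined by these `𝔽_l^{⋊±}`-symmetrizing isomorphisms" (cited by
[IUTchIII] Cor. 3.12, Step (vi); "We leave the routine details to the reader"). Typed ABSTRACTLY: a family of
maps `log_t : M_t → N_t` indexed by labels `t`, and symmetrising bijections `σ : M_t ≃ M_{t'}`, `τ : N_t ≃ N_{t'}`
for a group acting on labels, COMMUTE. Named `Prop` over that interface (owner of the real objects:
abc-iut-L6-t3 / L6-t2). [claim: Mochizuki2012, status: disputed] (IUTchIII §1 Rmk 1.3.2, kurims pp.43-44) -/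
def Rmk132_logLinkCompatible {T : Type u} (M N : T → Type u) (lg : ∀ t, M t → N t)
    {Γ : Type u} [Group Γ] [MulAction Γ T]
    (σ : ∀ (γ : Γ) (t : T), M t ≃ M (γ • t)) (τ : ∀ (γ : Γ) (t : T), N t ≃ N (γ • t)) : Prop :=
  ∀ (γ : Γ) (t : T) (x : M t), lg (γ • t) (σ γ t x) = τ γ t (lg t x)

/-! ## Rmk 1.4.1 (i): non-commutativity of the log-theta-lattice -/

/-- **IUTchIII:Rmk1.4.1(i)** (kurims p. 46): "the various squares that appear in each of the log-theta-lattices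
discussed in Definition 1.4 are far from being [1-]commutative!" (vertical arrows use the local ring
structures via the logarithm power series; horizontal arrows are incompatible with them, [IUTchII] Rmk.
1.11.2). Typed ABSTRACTLY over a lattice of objects `X n m` with vertical maps `up` and horizontal maps
`right` (as functions on some underlying sets): the square at `(n, m)` does not commute. Named `Prop` over the
interface (the log-theta-lattice itself is abc-iut-L6-t3's Def. 1.4).
[claim: Mochizuki2012, status: disputed] (IUTchIII §1 Rmk 1.4.1 (i), kurims p.46) -/
def Rmk141_notCommutative (X : ℤ → ℤ → Type u) (up : ∀ n m, X n m → X n (m + 1))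
    (right : ∀ n m, X n m → X (n + 1) m) : Prop :=
  ∀ n m : ℤ, ¬ ∀ x : X n m, up (n + 1) m (right n m x) = right n (m + 1) (up n m x)

/-! ## Rmk 1.5.1 (ii)'s identity (supporting t3's node) -/

/-- The group-theoretic identity quoted in **IUTchIII:Rmk1.5.1(i)**/(ii) (kurims p. 52): "to identify the
diagonal embedding `G ↪ G × G` with its `(G × G)`-conjugates implies that one must consider identifications
`(g, g) ∼ (g, hgh⁻¹) = (g, [h,g]·g)`" — PROVED: `(g, hgh⁻¹) = (g, ⁅h, g⁆·g)` in `G × G`, and `(g, hgh⁻¹)` is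
the conjugate of the diagonal element `(g, g)` by `(1, h)` (with `[h,g] = hgh⁻¹g⁻¹` written out).
[claim: Mochizuki2012, status: disputed] (IUTchIII §1 Rmk 1.5.1 (i), kurims p.52) -/
theorem conj_diag_eq_commutator_mul {G : Type u} [Group G] (g h : G) :
    ((1, h) : G × G) * (g, g) * (1, h)⁻¹ = (g, (h * g * h⁻¹ * g⁻¹) * g) ∧
      (h * g * h⁻¹ = (h * g * h⁻¹ * g⁻¹) * g) := by
  refine ⟨?_, by simp [mul_assoc]⟩
  ext <;> simp [mul_assoc]

end Literature.IUT.LogThetaLattice
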